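import Literature.AlgebraicGeometry.Resolution.StrictTransformFlatLocus
import Literature.AlgebraicGeometry.Resolution.BlowupsFlatBaseChange
import Literature.AlgebraicGeometry.Resolution.AlterationsProofs
import Literature.AlgebraicGeometry.Resolution.AlterationsResolution
import Literature.AlgebraicGeometry.Morphisms.GenericFibreSmooth
import Literature.AlgebraicGeometry.Motives.GenericFibre
import Mathlib.AlgebraicGeometry.Morphisms.SchemeTheoreticallyDominant
import Mathlib.AlgebraicGeometry.FunctionField
import HarnessLib

/-!
# The strict transform of an integral dominating scheme along a modification is a modification — PROVED (de Jong 1996, 2.18)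

Topic: `Literature/AlgebraicGeometry/Resolution`. Discharge of the named fact
`DeJong1996StrictTransformModification` of `StrictTransform.lean` (de Jong 1996, 2.18, p. 60:
"Let `f : X → S` be a morphism of finite type, with `S` Noetherian and integral. Let
`ψ : S' → S` be a modification. […] Thus if `X` is integral and dominates `S`, then `X' → X`
is a modification as well."), where `X' ⊆ X ×_S S'` is the strict transform — the
scheme-theoretic image of the generic fibre `Z = (X ×_S S')_{η'}` of `pr : X ×_S S' → S'` — and
`X' → X` is `strictTransformFst f ψ`; a modification (2.17, `IsModification`) is a proper
birational morphism from an integral scheme.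

## Proof

The printed argument ("Clearly, `X'|_{ψ⁻¹(U)} ≅ X ×_S ψ⁻¹(U)` and `X'` is the schematic closure
of this in `X ×_S S'`. Thus …") uses a flat locus `U` (generic flatness, 2.7). We run the same
argument over the dense open `V ⊆ S` over which the modification `ψ` is an ISOMORPHISM, which
avoids generic flatness. Put `U = f⁻¹(V) ⊆ X`, `W = pr_X⁻¹(U) ⊆ X ×_S S'`, and let
`j : Z → X ×_S S'`, `ι : X' ↪ X ×_S S'` be the inclusions.

1. `pr_X|_U : W → U` is an isomorphism, being the base change of `ψ|_V` along `f|_V`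
   (Mathlib `Scheme.Hom.isPullback_resLE`); hence `W → X` is an open immersion and `W` is
   integral (it contains the point `p₀` of `X ×_S S'` over `(ξ, η')`, `ξ`, `η'` the generic
   points of `X`, `S'`, both over the generic point of `S` because `f` and `ψ` are dominant).
2. `j` is a flat preimmersion: `Spec κ(η') → S'` is flat since `𝒪_{S',η'}` is the function
   field (`Literature.AlgebraicGeometry.Morphisms.flat_fromSpecResidueField_genericPoint`). Hence
   the stalk maps of `j` are isomorphisms (`isIso_stalkMap_of_flat_of_isPreimmersion`); `j` lands
   in `W`
   (`ψ(η')` is the generic point of `S`, which lies in `V`), whose local rings are reduced, so `Z`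
   is reduced, and then so is `X'`, the target of the quasi-compact scheme-theoretically dominant
   `Z → X'` (Stacks 01R8; Mathlib `IsSchemeTheoreticallyDominant.isReduced`).
3. `j|_W : j⁻¹(W) → W` hits the generic point `p₀` of `W`, so it is dominant, hence
   scheme-theoretically dominant as `W` is reduced; therefore the kernel of the closed immersion
   `ι|_W` (which is the kernel of `j|_W`) vanishes and `ι|_W` is an isomorphism — exactly as in
   `StrictTransformFlatLocus.lean`.
4. Birationality of `φ = ι ≫ pr_X : X' → X` over `U`: `U ∋ ξ` is dense in `X`;
   `φ⁻¹(U) = ι⁻¹(W)` contains the dense image of `Z → X'`; and `φ|_U = ι|_W ≫ pr_X|_U` is an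
   isomorphism. A birational morphism onto the integral `X` with reduced source has integral
   source (`IsBirational.isIntegral`), and `φ` is proper because `ψ` is. □

The hypotheses "`S` Noetherian" and "`f` of finite type" of 2.18 are not used for this
statement.

## Sources

* A. J. de Jong, *Smoothness, semi-stability and alterations*, Publ. Math. IHÉS 83 (1996) 51–93:
  2.17, 2.18 (p. 60). [DeJong1996]
* The Stacks Project, Tag 01R8 (scheme-theoretic image of a quasi-compact morphism; reduced
  source gives reduced image), Tag 01RN (birational). [StacksProject]
-/

noncomputable section

open CategoryTheory CategoryTheory.Limits AlgebraicGeometry TopologicalSpace Topology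

namespace Literature.AlgebraicGeometry.Resolution

universe u

/-! ## Generalities -/

section General

variable {X S S' : Scheme.{u}} (f : X ⟶ S) (ψ : S' ⟶ S)

/-- If `ψ : S' → S` is an isomorphism over the open `V ⊆ S`, then the projection
`X ×_S S' → X` is an isomorphism over `f⁻¹(V)`: it is the base change of `ψ|_V` along `f|_V`
(Mathlib `Scheme.Hom.isPullback_resLE`). [folklore] -/
theorem isIso_pullbackFst_morphismRestrict (V : S.Opens) [IsIso (ψ ∣_ V)] :
    IsIso (pullback.fst f ψ ∣_ f ⁻¹ᵁ V) := by
  have hUY : pullback.fst f ψ ⁻¹ᵁ (f ⁻¹ᵁ V) =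
      pullback.fst f ψ ⁻¹ᵁ (f ⁻¹ᵁ V) ⊓ pullback.snd f ψ ⁻¹ᵁ (ψ ⁻¹ᵁ V) := by
    rw [← Scheme.Hom.comp_preimage (pullback.fst f ψ) f, pullback.condition,
      Scheme.Hom.comp_preimage]
    exact (inf_idem _).symm
  have hsq := Scheme.Hom.isPullback_resLE (IsPullback.of_hasPullback f ψ) (US := V)
    (UT := ψ ⁻¹ᵁ V) (UX := f ⁻¹ᵁ V) le_rfl le_rfl hUY
  haveI : IsIso (ψ.resLE V (ψ ⁻¹ᵁ V) le_rfl) := by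
    rw [Scheme.Hom.resLE_eq_morphismRestrict]
    infer_instance
  have h := hsq.isIso_fst_of_isIso
  rwa [Scheme.Hom.resLE_eq_morphismRestrict] at h

/-- The inclusion of a fibre maps into the fibre. [folklore] -/
theorem apply_fiberι_apply {P T : Scheme.{u}} (g : P ⟶ T) (t : T) (z : g.fiber t) :
    g (g.fiberι t z) = t := by
  have h : g.fiberι t z ∈ g ⁻¹' {t} := by
    rw [← Scheme.Hom.range_fiberι]
    exact ⟨z, rfl⟩
  simpa using h

/-- A scheme admitting a flat preimmersion into a scheme whose local rings at the image points
are reduced is reduced (the stalk maps of a flat preimmersion are isomorphisms,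
`isIso_stalkMap_of_flat_of_isPreimmersion`). [folklore] -/
theorem isReduced_of_flat_of_isPreimmersion {Z P : Scheme.{u}} (j : Z ⟶ P) [Flat j]
    [IsPreimmersion j] (h : ∀ z : Z, _root_.IsReduced (P.presheaf.stalk (j z))) :
    IsReduced Z := by
  haveI : ∀ z : Z, _root_.IsReduced (Z.presheaf.stalk z) := fun z => by
    haveI := isIso_stalkMap_of_flat_of_isPreimmersion j z
    haveI := h z
    exact isReduced_of_injective (asIso (j.stalkMap z)).commRingCatIsoToRingEquiv.symm
      (asIso (j.stalkMap z)).commRingCatIsoToRingEquiv.symm.injective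
  exact isReduced_of_isReduced_stalk Z

end General

/-! ## The discharge -/

/-- **de Jong 1996, 2.18: "if `X` is integral and dominates `S`, then `X' → X` is a
modification as well" — PROVED**: the named fact `DeJong1996StrictTransformModification`
holds. [cite: DeJong1996, 2.18, p. 60] -/
theorem DeJong1996StrictTransformModification_holds :
    DeJong1996StrictTransformModification.{u} := by
  intro X S S' _ _ _ f _ _ _ ψ _ hψ
  haveI : IsProper ψ := hψ.isProper
  haveI : IsDominant ψ := hψ.isDominant
  obtain ⟨V, hVd, -, hViso⟩ := hψ.isBirational
  haveI := hViso
  -- generic points: `f ξ = η = ψ η'`, and `η ∈ V`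
  have hηV : genericPoint S ∈ V :=
    ((genericPoint_spec S).mem_open_set_iff V.isOpen).mpr (by simpa using hVd.nonempty)
  have hfξ : f (genericPoint X) = genericPoint S := genericPoint_eq_of_isDominant f
  have hψη : ψ (genericPoint S') = genericPoint S := genericPoint_eq_of_isDominant ψ
  have hξU : genericPoint X ∈ f ⁻¹ᵁ V := by
    show f (genericPoint X) ∈ V
    rw [hfξ]
    exact hηV
  -- Step 1: `pr_X` is an isomorphism over `U = f⁻¹ V`; the open `W = pr_X⁻¹ U` is integral
  haveI h1 : IsIso (pullback.fst f ψ ∣_ f ⁻¹ᵁ V) := isIso_pullbackFst_morphismRestrict f ψ V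
  haveI hWι : IsOpenImmersion ((pullback.fst f ψ ⁻¹ᵁ (f ⁻¹ᵁ V)).ι ≫ pullback.fst f ψ) := by
    rw [← morphismRestrict_ι]
    infer_instance
  obtain ⟨p₀, hp₀fst, hp₀snd⟩ := Scheme.Pullback.exists_preimage_pullback (f := f) (g := ψ)
    (genericPoint X) (genericPoint S') (by rw [hfξ, hψη])
  have hp₀W : p₀ ∈ pullback.fst f ψ ⁻¹ᵁ (f ⁻¹ᵁ V) := by
    show pullback.fst f ψ p₀ ∈ f ⁻¹ᵁ V
    rw [hp₀fst]
    exact hξU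
  haveI : Nonempty (↑(pullback.fst f ψ ⁻¹ᵁ (f ⁻¹ᵁ V)) : Scheme.{u}) := ⟨⟨p₀, hp₀W⟩⟩
  haveI hWint : IsIntegral (↑(pullback.fst f ψ ⁻¹ᵁ (f ⁻¹ᵁ V)) : Scheme.{u}) :=
    isIntegral_of_isOpenImmersion ((pullback.fst f ψ ⁻¹ᵁ (f ⁻¹ᵁ V)).ι ≫ pullback.fst f ψ)
  -- Step 2: the generic fibre `j : Z → X ×_S S'` lands in `W`; `Z` and `X'` are reduced
  have hjsnd : ∀ z, pullback.snd f ψ ((pullback.snd f ψ).fiberι (genericPoint S') z) =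
      genericPoint S' := fun z => apply_fiberι_apply _ _ z
  have hjW : ∀ z, (pullback.snd f ψ).fiberι (genericPoint S') z ∈
      pullback.fst f ψ ⁻¹ᵁ (f ⁻¹ᵁ V) := by
    intro z
    show f (pullback.fst f ψ ((pullback.snd f ψ).fiberι (genericPoint S') z)) ∈ V
    rw [← Scheme.Hom.comp_apply, pullback.condition, Scheme.Hom.comp_apply, hjsnd, hψη]
    exact hηV
  haveI : Flat (S'.fromSpecResidueField (genericPoint S')) :=
    Literature.AlgebraicGeometry.Morphisms.flat_fromSpecResidueField_genericPoint S'
  haveI : Flat ((pullback.snd f ψ).fiberι (genericPoint S')) :=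
    MorphismProperty.pullback_fst (P := @Flat) _ _ inferInstance
  haveI hZred : IsReduced ((pullback.snd f ψ).fiber (genericPoint S')) := by
    refine isReduced_of_flat_of_isPreimmersion ((pullback.snd f ψ).fiberι (genericPoint S'))
      fun z => ?_
    let w : (↑(pullback.fst f ψ ⁻¹ᵁ (f ⁻¹ᵁ V)) : Scheme.{u}) := ⟨_, hjW z⟩
    exact isReduced_of_injective
      ((pullback.fst f ψ ⁻¹ᵁ (f ⁻¹ᵁ V)).stalkIso w).commRingCatIsoToRingEquiv.symm
      ((pullback.fst f ψ ⁻¹ᵁ (f ⁻¹ᵁ V)).stalkIso w).commRingCatIsoToRingEquiv.symm.injective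
  haveI := Literature.AlgebraicGeometry.Motives.quasiCompact_fiberι (pullback.snd f ψ)
    (genericPoint S')
  haveI : IsSchemeTheoreticallyDominant (toStrictTransform f ψ) :=
    Literature.AlgebraicGeometry.Motives.isSchemeTheoreticallyDominant_toImage _
  haveI : QuasiCompact (toStrictTransform f ψ) :=
    inferInstanceAs (QuasiCompact ((pullback.snd f ψ).fiberι (genericPoint S')).toImage)
  haveI hX'red : IsReduced (strictTransform f ψ) :=
    IsSchemeTheoreticallyDominant.isReduced (toStrictTransform f ψ)
  -- Step 3: `j|_W` hits the generic point `p₀` of `W`, so it is (scheme-theoretically)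
  -- dominant, and `ι : X' ↪ X ×_S S'` is an isomorphism over `W`
  have hw₀ : genericPoint (↑(pullback.fst f ψ ⁻¹ᵁ (f ⁻¹ᵁ V)) : Scheme.{u}) = ⟨p₀, hp₀W⟩ := by
    apply ((pullback.fst f ψ ⁻¹ᵁ (f ⁻¹ᵁ V)).ι ≫ pullback.fst f ψ).isOpenEmbedding.injective
    rw [genericPoint_eq_of_isOpenImmersion, Scheme.Hom.comp_apply, Scheme.Opens.ι_apply,
      hp₀fst]
  have hp₀range : p₀ ∈ Set.range ((pullback.snd f ψ).fiberι (genericPoint S')) := by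
    rw [Scheme.Hom.range_fiberι]
    exact hp₀snd
  obtain ⟨z₀, hz₀⟩ := hp₀range
  haveI : IsDominant
      ((pullback.snd f ψ).fiberι (genericPoint S') ∣_ pullback.fst f ψ ⁻¹ᵁ (f ⁻¹ᵁ V)) := by
    refine ⟨?_⟩
    have hz₀W : z₀ ∈
        (pullback.snd f ψ).fiberι (genericPoint S') ⁻¹ᵁ (pullback.fst f ψ ⁻¹ᵁ (f ⁻¹ᵁ V)) := by
      show (pullback.snd f ψ).fiberι (genericPoint S') z₀ ∈ pullback.fst f ψ ⁻¹ᵁ (f ⁻¹ᵁ V)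
      rw [hz₀]
      exact hp₀W
    have hmem : genericPoint (↑(pullback.fst f ψ ⁻¹ᵁ (f ⁻¹ᵁ V)) : Scheme.{u}) ∈ Set.range
        ((pullback.snd f ψ).fiberι (genericPoint S') ∣_ pullback.fst f ψ ⁻¹ᵁ (f ⁻¹ᵁ V)) := by
      refine ⟨⟨z₀, hz₀W⟩, ?_⟩
      rw [hw₀]
      apply Subtype.ext
      rw [morphismRestrict_base_coe]
      exact hz₀
    exact (dense_singleton_genericPoint _).mono (Set.singleton_subset_iff.mpr hmem)
  haveI : IsSchemeTheoreticallyDominant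
      ((pullback.snd f ψ).fiberι (genericPoint S') ∣_ pullback.fst f ψ ⁻¹ᵁ (f ⁻¹ᵁ V)) :=
    .of_isDominant _
  have hker : (strictTransformι f ψ).ker = ((pullback.snd f ψ).fiberι (genericPoint S')).ker :=
    Scheme.IdealSheafData.ker_subschemeι _
  have hbot : (strictTransformι f ψ ∣_ pullback.fst f ψ ⁻¹ᵁ (f ⁻¹ᵁ V)).ker = ⊥ :=
    ker_morphismRestrict_eq_bot_of_ker_eq _ _ hker _
  haveI : IsClosedImmersion (strictTransformι f ψ ∣_ pullback.fst f ψ ⁻¹ᵁ (f ⁻¹ᵁ V)) :=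
    IsZariskiLocalAtTarget.restrict (P := @IsClosedImmersion) inferInstance _
  haveI h3 : IsIso (strictTransformι f ψ ∣_ pullback.fst f ψ ⁻¹ᵁ (f ⁻¹ᵁ V)) :=
    IsClosedImmersion.isIso_iff_ker_eq_bot.mpr hbot
  -- Step 4: `φ = ι ≫ pr_X : X' → X` is birational (over `U`), proper, with integral source
  have hbir : IsBirational (strictTransformFst f ψ) := by
    refine ⟨f ⁻¹ᵁ V, (f ⁻¹ᵁ V).2.dense ⟨_, hξU⟩, ?_, ?_⟩
    · -- `φ⁻¹ U = ι⁻¹ W` contains the dense image of the generic fibre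
      have hsub : Set.range (toStrictTransform f ψ) ⊆
          ((strictTransformFst f ψ ⁻¹ᵁ (f ⁻¹ᵁ V) : (strictTransform f ψ).Opens) :
            Set (strictTransform f ψ)) := by
        rintro _ ⟨z, rfl⟩
        have hz : strictTransformι f ψ (toStrictTransform f ψ z) =
            (pullback.snd f ψ).fiberι (genericPoint S') z := by
          rw [← Scheme.Hom.comp_apply, toStrictTransform_ι]
        show pullback.fst f ψ (strictTransformι f ψ (toStrictTransform f ψ z)) ∈ f ⁻¹ᵁ V
        rw [hz]
        exact hjW z
      exact (toStrictTransform f ψ).denseRange.mono hsub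
    · show IsIso ((strictTransformι f ψ ≫ pullback.fst f ψ) ∣_ f ⁻¹ᵁ V)
      rw [morphismRestrict_comp]
      exact IsIso.comp_isIso (f := strictTransformι f ψ ∣_ pullback.fst f ψ ⁻¹ᵁ (f ⁻¹ᵁ V))
        (h := pullback.fst f ψ ∣_ f ⁻¹ᵁ V)
  haveI : IsIntegral (strictTransform f ψ) := hbir.isIntegral
  exact ⟨inferInstance, inferInstance, hbir⟩

end Literature.AlgebraicGeometry.Resolution

end
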